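import Mathlib.Algebra.Order.BigOperators.Ring.Finset
import Mathlib.Algebra.BigOperators.Ring.Finset
import Mathlib.Analysis.SpecialFunctions.Pow.Real
import HarnessLib

/-!
# The super-terminal quartic law `V4` under parallel composition at `{s,a,b,c}` — the algebraic core

Support file for crux `stmt-CriticalPhenomena-4575` (`NoHeavyLowerTail`), seat `prim-nh-lead-4575` lead gen 131 (`--supports stmt-CriticalPhenomena-4575`;
memo `run/shared/lean/prim/prim-nh-lead-4575/FROM-prim-nh-lead-4575-g131-P3HALF-BHK-SPLIT.md` §6, INEQ-CLAIMS l.3897).  No definitions, no sorries, standard axioms.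

THE PARALLEL-COMPOSITION PRINCIPLE (memo §6 (ii)).  Glue finitely many 4-terminal gadgets `G_i` at the root `s`, its block partner `a`, the singleton `b` and the port
`c`.  Writing the cells of the 4-point partition law of gadget `i` as `n = P(s|a|b|c)`, `σ = P(sa|b|c)`, `ζ = P(sa|cb)`, `β = P(cb|s|a)`, `ξ = P(sc|a|b) + P(ac|s|b)`
(`ξs + ξa`), `τ = P(sac|b)`, `γ = P(c singleton)`, the join rule gives for the composite
`Q = ∏(n+σ) − ∏ n`, `A = ∏(n+σ+β+ζ) − ∏(n+β)`, `B = ∏(n+σ+ξs+ξa+τ) − ∏(n+ξs) − ∏(n+ξa) + ∏ n`, `C = ∏ γ`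
(`Q = μ(F ∩ c∤T)`, `A = μ(F ∩ c∤S)`, `B = μ(F ∩ c↮b)`, `C = μ(c∤T)`, `F = (s↔a) ∩ (s↮b)`).  THIS FILE proves the real-algebra statement behind
"`V4` and `(H1)` for every piece ⟹ `V4` for the composite":

* `prod_add_sub_prod` — `∏(x+y) − ∏ x = ∑_{∅ ≠ t ⊆ s} (∏_t y)(∏_{s∖t} x)` (the expansion over the set `t` of `sa`-providing pieces);
* `prod_supermod` — `∏(n+ξs) + ∏(n+ξa) ≤ ∏(n+ξs+ξa) + ∏ n` for nonnegative entries (so `B ≥ ∏(n+σ+ξ+τ) − ∏(n+ξ)`, `ξ = ξs+ξa`);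
* `termwise` — the piecewise hypotheses `σ⁴ ≤ (σ+ζ)²(σ+τ)²γ` (`V4` of the piece) and `n⁴ ≤ (n+β)²(n+ξ)²γ` (the row `(H1)`) multiply to
  `q_t⁴ ≤ a_t² b_t² C` for every `t`;
* `sum_pow_four_le` — Cauchy–Schwarz: `q_t⁴ ≤ a_t²b_t²C` for all `t` ⟹ `(∑ q)⁴ ≤ (∑ a)²(∑ b)²C`;
* `quartic_parallel` — **`(∏(n+σ) − ∏ n)⁴ ≤ (∏(n+σ+β+ζ) − ∏(n+β))² · (∏(n+σ+ξs+ξa+τ) − ∏(n+ξs) − ∏(n+ξa) + ∏ n)² · ∏ γ`** under the two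
  piecewise hypotheses and nonnegativity.
Star gadgets (one internal vertex) satisfy both hypotheses (memo §6 (iii): `V4` by `σ+τ = σ/(1−w_c)`, `γ ≥ 1−w_c`; `(H1)` by an exact tensor-Bernstein
certificate, 1296 coefficients ≥ 0, `lab-gen131/p3/hubH1_certificate.json`), which gives the THEOREM "`V4` on every graph in which `{s,a,b,c}` is a vertex cover";
the graph-level identities (join rule, `Literature.Probability.Percolation.PartitionGluing.real_partLE`) and the star certificate are not in this file.
-/

namespace Summit.CriticalPhenomena.PercolationContinuityZ3.Theorems.SuperTerminalQuarticParallel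

open Finset Real

variable {ι : Type*} [DecidableEq ι]

/-- Expansion over the nonempty subsets: `∏_{i∈s}(x i + y i) − ∏_{i∈s} x i = ∑_{t ∈ 𝒫(s), t ≠ ∅} (∏_{i∈t} y i)·(∏_{i∈s∖t} x i)`. [folklore] -/
theorem prod_add_sub_prod (s : Finset ι) (x y : ι → ℝ) :
    ∏ i ∈ s, (x i + y i) - ∏ i ∈ s, x i = ∑ t ∈ s.powerset.erase ∅, (∏ i ∈ t, y i) * ∏ i ∈ s \ t, x i := by
  have h := Finset.prod_add y x s
  have h0 : (∅ : Finset ι) ∈ s.powerset := Finset.mem_powerset.mpr (Finset.empty_subset s)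
  rw [Finset.sum_erase_eq_sub h0, Finset.prod_empty, Finset.sdiff_empty, one_mul, ← h]
  congr 1
  exact Finset.prod_congr rfl fun i _ => add_comm (x i) (y i)

/-- Supermodularity of products with nonnegative entries: `∏(n+ξs) + ∏(n+ξa) ≤ ∏(n+ξs+ξa) + ∏ n`. [folklore] -/
theorem prod_supermod (s : Finset ι) (n ξs ξa : ι → ℝ) (hn : ∀ i ∈ s, 0 ≤ n i) (hs : ∀ i ∈ s, 0 ≤ ξs i) (ha : ∀ i ∈ s, 0 ≤ ξa i) :
    ∏ i ∈ s, (n i + ξs i) + ∏ i ∈ s, (n i + ξa i) ≤ ∏ i ∈ s, (n i + ξs i + ξa i) + ∏ i ∈ s, n i := by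
  induction s using Finset.induction_on with
  | empty => simp
  | @insert j s hj ih =>
    have hn' : ∀ i ∈ s, 0 ≤ n i := fun i hi => hn i (Finset.mem_insert_of_mem hi)
    have hs' : ∀ i ∈ s, 0 ≤ ξs i := fun i hi => hs i (Finset.mem_insert_of_mem hi)
    have ha' : ∀ i ∈ s, 0 ≤ ξa i := fun i hi => ha i (Finset.mem_insert_of_mem hi)
    have IH := ih hn' hs' ha'
    have hnj := hn j (Finset.mem_insert_self j s)
    have hsj := hs j (Finset.mem_insert_self j s)
    have haj := ha j (Finset.mem_insert_self j s)
    -- monotonicity of the four products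
    have m13 : ∏ i ∈ s, (n i + ξs i) ≤ ∏ i ∈ s, (n i + ξs i + ξa i) :=
      Finset.prod_le_prod (fun i hi => by linarith [hn' i hi, hs' i hi]) (fun i hi => by linarith [ha' i hi])
    have m14 : ∏ i ∈ s, (n i + ξa i) ≤ ∏ i ∈ s, (n i + ξs i + ξa i) :=
      Finset.prod_le_prod (fun i hi => by linarith [hn' i hi, ha' i hi]) (fun i hi => by linarith [hs' i hi])
    have p2 : 0 ≤ ∏ i ∈ s, n i := Finset.prod_nonneg hn'
    rw [Finset.prod_insert hj, Finset.prod_insert hj, Finset.prod_insert hj, Finset.prod_insert hj]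
    nlinarith [IH, m13, m14, p2, mul_nonneg hnj (sub_nonneg.mpr m13), mul_nonneg hsj (sub_nonneg.mpr m13),
      mul_nonneg haj (sub_nonneg.mpr m14)]

/-- From `q⁴ ≤ a²b²C` (all nonnegative) to `q² ≤ a·(b·√C)`. [folklore] -/
theorem sq_le_of_pow_four_le {q a b C : ℝ} (ha : 0 ≤ a) (hb : 0 ≤ b) (hC : 0 ≤ C)
    (h : q ^ 4 ≤ a ^ 2 * b ^ 2 * C) : q ^ 2 ≤ a * (b * Real.sqrt C) := by
  have hR : 0 ≤ a * (b * Real.sqrt C) := by positivity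
  have h2 : (q ^ 2) ^ 2 ≤ (a * (b * Real.sqrt C)) ^ 2 := by
    have e1 : (q ^ 2) ^ 2 = q ^ 4 := by ring
    have e2 : (a * (b * Real.sqrt C)) ^ 2 = a ^ 2 * b ^ 2 * C := by
      rw [show (a * (b * Real.sqrt C)) ^ 2 = a ^ 2 * b ^ 2 * (Real.sqrt C) ^ 2 by ring, Real.sq_sqrt hC]
    rw [e1, e2]; exact h
  exact (pow_le_pow_iff_left₀ (by positivity) hR two_ne_zero).mp h2

/-- **Cauchy–Schwarz step.**  If `q_t, a_t, b_t ≥ 0` and `q_t⁴ ≤ a_t²·b_t²·C` for every `t ∈ T` (`C ≥ 0`), then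
`(∑ q)⁴ ≤ (∑ a)²·(∑ b)²·C`. [this work] -/
theorem sum_pow_four_le {κ : Type*} (T : Finset κ) (q a b : κ → ℝ) {C : ℝ} (hC : 0 ≤ C)
    (ha : ∀ t ∈ T, 0 ≤ a t) (hb : ∀ t ∈ T, 0 ≤ b t)
    (h : ∀ t ∈ T, q t ^ 4 ≤ a t ^ 2 * b t ^ 2 * C) :
    (∑ t ∈ T, q t) ^ 4 ≤ (∑ t ∈ T, a t) ^ 2 * (∑ t ∈ T, b t) ^ 2 * C := by
  have hbC : ∀ t ∈ T, 0 ≤ b t * Real.sqrt C := fun t ht => mul_nonneg (hb t ht) (Real.sqrt_nonneg C)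
  have key : (∑ t ∈ T, q t) ^ 2 ≤ (∑ t ∈ T, a t) * ∑ t ∈ T, b t * Real.sqrt C :=
    Finset.sum_sq_le_sum_mul_sum_of_sq_le_mul T ha hbC
      (fun t ht => sq_le_of_pow_four_le (ha t ht) (hb t ht) hC (h t ht))
  have hsum : ∑ t ∈ T, b t * Real.sqrt C = (∑ t ∈ T, b t) * Real.sqrt C := by rw [Finset.sum_mul]
  rw [hsum] at key
  have key2 : ((∑ t ∈ T, q t) ^ 2) ^ 2 ≤ ((∑ t ∈ T, a t) * ((∑ t ∈ T, b t) * Real.sqrt C)) ^ 2 :=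
    pow_le_pow_left₀ (by positivity) key 2
  calc (∑ t ∈ T, q t) ^ 4 = ((∑ t ∈ T, q t) ^ 2) ^ 2 := by ring
    _ ≤ ((∑ t ∈ T, a t) * ((∑ t ∈ T, b t) * Real.sqrt C)) ^ 2 := key2
    _ = (∑ t ∈ T, a t) ^ 2 * (∑ t ∈ T, b t) ^ 2 * (Real.sqrt C) ^ 2 := by ring
    _ = (∑ t ∈ T, a t) ^ 2 * (∑ t ∈ T, b t) ^ 2 * C := by rw [Real.sq_sqrt hC]

/-- **Termwise domination.**  For `t ⊆ s`, the piecewise hypotheses `σ⁴ ≤ (σ+ζ)²(σ+τ)²γ` (on `t`) and `n⁴ ≤ (n+β)²(n+ξ)²γ` (on `s ∖ t`) multiply to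
`(∏_t σ · ∏_{s∖t} n)⁴ ≤ (∏_t(σ+ζ) · ∏_{s∖t}(n+β))² · (∏_t(σ+τ) · ∏_{s∖t}(n+ξ))² · ∏_s γ`. [this work] -/
theorem termwise (s t : Finset ι) (hts : t ⊆ s) (n σ ζ β ξ τ γ : ι → ℝ)
    (hn : ∀ i ∈ s, 0 ≤ n i) (hσ : ∀ i ∈ s, 0 ≤ σ i)
    (hV : ∀ i ∈ s, σ i ^ 4 ≤ (σ i + ζ i) ^ 2 * (σ i + τ i) ^ 2 * γ i)
    (hH : ∀ i ∈ s, n i ^ 4 ≤ (n i + β i) ^ 2 * (n i + ξ i) ^ 2 * γ i) :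
    ((∏ i ∈ t, σ i) * ∏ i ∈ s \ t, n i) ^ 4 ≤
      ((∏ i ∈ t, (σ i + ζ i)) * ∏ i ∈ s \ t, (n i + β i)) ^ 2 *
        ((∏ i ∈ t, (σ i + τ i)) * ∏ i ∈ s \ t, (n i + ξ i)) ^ 2 * ∏ i ∈ s, γ i := by
  have hsub : ∀ i ∈ s \ t, i ∈ s := fun i hi => (Finset.mem_sdiff.mp hi).1
  have h1 : ∏ i ∈ t, σ i ^ 4 ≤ ∏ i ∈ t, ((σ i + ζ i) ^ 2 * (σ i + τ i) ^ 2 * γ i) :=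
    Finset.prod_le_prod (fun i hi => pow_nonneg (hσ i (hts hi)) 4) (fun i hi => hV i (hts hi))
  have h2 : ∏ i ∈ s \ t, n i ^ 4 ≤ ∏ i ∈ s \ t, ((n i + β i) ^ 2 * (n i + ξ i) ^ 2 * γ i) :=
    Finset.prod_le_prod (fun i hi => pow_nonneg (hn i (hsub i hi)) 4) (fun i hi => hH i (hsub i hi))
  have h1n : 0 ≤ ∏ i ∈ t, σ i ^ 4 := Finset.prod_nonneg fun i hi => pow_nonneg (hσ i (hts hi)) 4
  have h2n : 0 ≤ ∏ i ∈ s \ t, n i ^ 4 := Finset.prod_nonneg fun i hi => pow_nonneg (hn i (hsub i hi)) 4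
  have hγ : ∏ i ∈ s, γ i = (∏ i ∈ t, γ i) * ∏ i ∈ s \ t, γ i := by
    rw [mul_comm, Finset.prod_sdiff hts]
  calc ((∏ i ∈ t, σ i) * ∏ i ∈ s \ t, n i) ^ 4
      = (∏ i ∈ t, σ i ^ 4) * ∏ i ∈ s \ t, n i ^ 4 := by rw [mul_pow, Finset.prod_pow, Finset.prod_pow]
    _ ≤ (∏ i ∈ t, ((σ i + ζ i) ^ 2 * (σ i + τ i) ^ 2 * γ i)) * ∏ i ∈ s \ t, ((n i + β i) ^ 2 * (n i + ξ i) ^ 2 * γ i) :=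
        mul_le_mul h1 h2 h2n (le_trans h1n h1)
    _ = ((∏ i ∈ t, (σ i + ζ i)) * ∏ i ∈ s \ t, (n i + β i)) ^ 2 *
        ((∏ i ∈ t, (σ i + τ i)) * ∏ i ∈ s \ t, (n i + ξ i)) ^ 2 * ∏ i ∈ s, γ i := by
        rw [hγ, Finset.prod_mul_distrib, Finset.prod_mul_distrib, Finset.prod_mul_distrib, Finset.prod_mul_distrib,
          Finset.prod_pow, Finset.prod_pow, Finset.prod_pow, Finset.prod_pow]
        ring

/-- **The parallel-composition principle for `V4` (algebraic core; memo §6 (ii)).**  Pieces `i ∈ s` with nonnegative cells `n, σ, ζ, β, ξs, ξa, τ, γ`;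
if every piece satisfies `V4` (`σ⁴ ≤ (σ+ζ)²(σ+τ)²γ`) and the row `(H1)` (`n⁴ ≤ (n+β)²(n+ξs+ξa)²γ`), then the composite quantities
`Q = ∏(n+σ) − ∏ n`, `A = ∏(n+σ+β+ζ) − ∏(n+β)`, `B = ∏(n+σ+ξs+ξa+τ) − ∏(n+ξs) − ∏(n+ξa) + ∏ n`, `C = ∏ γ` satisfy `Q⁴ ≤ A²·B²·C`. [this work] -/
theorem quartic_parallel (s : Finset ι) (n σ ζ β ξs ξa τ γ : ι → ℝ)
    (hn : ∀ i ∈ s, 0 ≤ n i) (hσ : ∀ i ∈ s, 0 ≤ σ i) (hζ : ∀ i ∈ s, 0 ≤ ζ i) (hβ : ∀ i ∈ s, 0 ≤ β i)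
    (hξs : ∀ i ∈ s, 0 ≤ ξs i) (hξa : ∀ i ∈ s, 0 ≤ ξa i) (hτ : ∀ i ∈ s, 0 ≤ τ i) (hγ : ∀ i ∈ s, 0 ≤ γ i)
    (hV : ∀ i ∈ s, σ i ^ 4 ≤ (σ i + ζ i) ^ 2 * (σ i + τ i) ^ 2 * γ i)
    (hH : ∀ i ∈ s, n i ^ 4 ≤ (n i + β i) ^ 2 * (n i + ξs i + ξa i) ^ 2 * γ i) :
    (∏ i ∈ s, (n i + σ i) - ∏ i ∈ s, n i) ^ 4 ≤
      (∏ i ∈ s, (n i + σ i + β i + ζ i) - ∏ i ∈ s, (n i + β i)) ^ 2 *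
        (∏ i ∈ s, (n i + σ i + ξs i + ξa i + τ i) - ∏ i ∈ s, (n i + ξs i) - ∏ i ∈ s, (n i + ξa i) + ∏ i ∈ s, n i) ^ 2 *
          ∏ i ∈ s, γ i := by
  set T := s.powerset.erase ∅ with hT
  -- the three expansions over the nonempty set `t` of `sa`-providers
  have eQ : ∏ i ∈ s, (n i + σ i) - ∏ i ∈ s, n i = ∑ t ∈ T, (∏ i ∈ t, σ i) * ∏ i ∈ s \ t, n i :=
    prod_add_sub_prod s n σ
  have eA : ∏ i ∈ s, (n i + σ i + β i + ζ i) - ∏ i ∈ s, (n i + β i) =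
      ∑ t ∈ T, (∏ i ∈ t, (σ i + ζ i)) * ∏ i ∈ s \ t, (n i + β i) := by
    rw [← prod_add_sub_prod s (fun i => n i + β i) (fun i => σ i + ζ i)]
    congr 1
    exact Finset.prod_congr rfl fun i _ => by ring
  have eB0 : ∏ i ∈ s, (n i + σ i + ξs i + ξa i + τ i) - ∏ i ∈ s, (n i + ξs i + ξa i) =
      ∑ t ∈ T, (∏ i ∈ t, (σ i + τ i)) * ∏ i ∈ s \ t, (n i + (ξs i + ξa i)) := by
    rw [← prod_add_sub_prod s (fun i => n i + (ξs i + ξa i)) (fun i => σ i + τ i)]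
    congr 1
    · exact Finset.prod_congr rfl fun i _ => by ring
    · exact Finset.prod_congr rfl fun i _ => by ring
  -- `B ≥ B₀ ≥ 0`
  have hsuper := prod_supermod s n ξs ξa hn hξs hξa
  set B := ∏ i ∈ s, (n i + σ i + ξs i + ξa i + τ i) - ∏ i ∈ s, (n i + ξs i) - ∏ i ∈ s, (n i + ξa i) + ∏ i ∈ s, n i with hB
  set B0 := ∏ i ∈ s, (n i + σ i + ξs i + ξa i + τ i) - ∏ i ∈ s, (n i + ξs i + ξa i) with hB0
  have hBB0 : B0 ≤ B := by rw [hB, hB0]; linarith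
  have hB0nn : 0 ≤ B0 := by
    rw [eB0]
    refine Finset.sum_nonneg fun t ht => mul_nonneg (Finset.prod_nonneg fun i hi => ?_) (Finset.prod_nonneg fun i hi => ?_)
    · have his : i ∈ s := Finset.mem_powerset.mp (Finset.mem_of_mem_erase ht) hi
      linarith [hσ i his, hτ i his]
    · have his : i ∈ s := (Finset.mem_sdiff.mp hi).1
      linarith [hn i his, hξs i his, hξa i his]
  -- termwise + Cauchy–Schwarz gives `Q⁴ ≤ A²·B₀²·C`
  have hC : 0 ≤ ∏ i ∈ s, γ i := Finset.prod_nonneg hγ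
  have main : (∑ t ∈ T, (∏ i ∈ t, σ i) * ∏ i ∈ s \ t, n i) ^ 4 ≤
      (∑ t ∈ T, (∏ i ∈ t, (σ i + ζ i)) * ∏ i ∈ s \ t, (n i + β i)) ^ 2 *
        (∑ t ∈ T, (∏ i ∈ t, (σ i + τ i)) * ∏ i ∈ s \ t, (n i + (ξs i + ξa i))) ^ 2 * ∏ i ∈ s, γ i := by
    refine sum_pow_four_le T _ _ _ hC (fun t ht => ?_) (fun t ht => ?_) (fun t ht => ?_)
    · have hts : t ⊆ s := Finset.mem_powerset.mp (Finset.mem_of_mem_erase ht)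
      exact mul_nonneg (Finset.prod_nonneg fun i hi => by linarith [hσ i (hts hi), hζ i (hts hi)])
        (Finset.prod_nonneg fun i hi => by have := (Finset.mem_sdiff.mp hi).1; linarith [hn i this, hβ i this])
    · have hts : t ⊆ s := Finset.mem_powerset.mp (Finset.mem_of_mem_erase ht)
      exact mul_nonneg (Finset.prod_nonneg fun i hi => by linarith [hσ i (hts hi), hτ i (hts hi)])
        (Finset.prod_nonneg fun i hi => by have := (Finset.mem_sdiff.mp hi).1; linarith [hn i this, hξs i this, hξa i this])
    · have hts : t ⊆ s := Finset.mem_powerset.mp (Finset.mem_of_mem_erase ht)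
      exact termwise s t hts n σ ζ β (fun i => ξs i + ξa i) τ γ hn hσ hV (fun i hi => by simpa [add_assoc] using hH i hi)
  rw [eQ, eA]
  rw [← eB0] at main
  -- replace `B₀` by `B`
  have hA2 : 0 ≤ (∑ t ∈ T, (∏ i ∈ t, (σ i + ζ i)) * ∏ i ∈ s \ t, (n i + β i)) ^ 2 := sq_nonneg _
  have hsq : B0 ^ 2 ≤ B ^ 2 := pow_le_pow_left₀ hB0nn hBB0 2
  calc (∑ t ∈ T, (∏ i ∈ t, σ i) * ∏ i ∈ s \ t, n i) ^ 4
      ≤ (∑ t ∈ T, (∏ i ∈ t, (σ i + ζ i)) * ∏ i ∈ s \ t, (n i + β i)) ^ 2 * B0 ^ 2 * ∏ i ∈ s, γ i := main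
    _ ≤ (∑ t ∈ T, (∏ i ∈ t, (σ i + ζ i)) * ∏ i ∈ s \ t, (n i + β i)) ^ 2 * B ^ 2 * ∏ i ∈ s, γ i := by
        gcongr

end Summit.CriticalPhenomena.PercolationContinuityZ3.Theorems.SuperTerminalQuarticParallel
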